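import Mathlib
import Literature.NumberTheory.Sieve.LinearEquationsInPrimesTwinSystem
import Summits.Parity.GeneralizedHardyLittlewood.Theorems.LiouvilleShiftedTablesPairsToGHLStubToBoundedAux2
import Summits.Parity.GeneralizedHardyLittlewood.Theorems.LeeYangFibresRelativeDimOneArchFactsAux

/-!
# Green–Tao normalisation in dimension one, III: `stub_toBounded`
# (crux `PairsToGHL`, stmt-Parity-9389, line `sloped_ladder`)

From "elementary Hardy–Littlewood for every fixed POSITIVE non-degenerate one-dimensional system on
`n ∈ [1, N]` with main term `𝔖(Φ) N`" (the output of the sloped ladder) we deduce `BoundedDickson`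
verbatim: for every fixed non-degenerate `Φ : Fin t → AffLinForm 1` (any signs of slopes and
shifts), every convex `K ⊆ [-N, N]¹` and every `ε > 0`,
`|∑_{n ∈ K ∩ ℤ} ∏ᵢ Λ(ψᵢ(n)) − β_∞ ∏_p β_p| ≤ ε N` for `N ≥ N₀(Φ, ε)` (Green–Tao 2010, (1.2)–(1.4)
for `d = 1`).  The transport `ℝ¹ ↔ ℝ` (`vonMangoldtSum_eq_sum_slice`, `archFactor_eq_volume_slice`,
tree file `LinearEquationsInPrimesDimOne`) reduces everything to the slice
`K' = {r : (r) ∈ K} ⊆ [-N, N]` of `K`, an interval.  Three cases: all slopes positive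
(`sameSign_case`, `u = 1`: translate to make the shifts non-negative — local factors and `𝔖` are
translation-invariant — and compare lattice points of `K' ∩ {ψᵢ > 0 ∀ i}` with its length); all
slopes negative (`u = -1`: reflect `n ↦ -n`); mixed signs (`mixed_case`: the positivity region is
a bounded window, so both terms are `O_Φ(1)`).

References: B. Green, T. Tao, *Linear equations in primes*, Ann. of Math. 171 (2010), (1.2)–(1.4),
App. A.
-/

namespace Summit.Parity.GeneralizedHardyLittlewood.Theorems.PairsToGHL.SlopedLadder

namespace ToBounded

open Finset Filter MeasureTheory
open Literature.NumberTheory.Sieve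

noncomputable section

variable {t : ℕ}

/-! ### Transport `ℝ¹ ↔ ℝ` -/

/-- The slice `{r : (r) ∈ K}` of a convex body `K ⊆ ℝ¹` is an interval. [folklore] -/
theorem ordConnected_slice {K : Set (Fin 1 → ℝ)} (hK : Convex ℝ K) :
    ({r : ℝ | (fun _ : Fin 1 => r) ∈ K}).OrdConnected :=
  (DimOne.convex_slice hK).ordConnected

open Classical in
/-- **The von Mangoldt sum in dimension one** is the sum of the tuple weight
`F_Φ(m) = ∏ᵢ Λ(aᵢ m + bᵢ)` over the integers `m ∈ [-N, N]` whose real point lies in the slice of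
`K`. [cite: GreenTao2010, (1.2)] -/
theorem vonMangoldtSum_eq_sum_slice (Φ : Fin t → AffLinForm 1) (K : Set (Fin 1 → ℝ)) (N : ℕ) :
    vonMangoldtSum Φ K N =
      ∑ m ∈ (Finset.Icc (-(N : ℤ)) N).filter (fun m : ℤ => (m : ℝ) ∈ {r : ℝ | (fun _ : Fin 1 => r) ∈ K}),
        ∏ i, intVonMangoldt ((Φ i).coeff 0 * m + (Φ i).const) := by
  unfold vonMangoldtSum latticeBox
  rw [Finset.sum_filter, Finset.sum_filter, sum_piFinset_const_fin_one]
  refine Finset.sum_congr rfl fun m _ => ?_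
  have hpt : realPoint (fun _ : Fin 1 => m) ∈ K ↔ (m : ℝ) ∈ {r : ℝ | (fun _ : Fin 1 => r) ∈ K} :=
    Iff.rfl
  have hw : ∏ i, intVonMangoldt ((Φ i).eval fun _ => m) =
      ∏ i, intVonMangoldt ((Φ i).coeff 0 * m + (Φ i).const) :=
    Finset.prod_congr rfl fun i _ => by rw [DimOne.eval_eq]
  by_cases h : (m : ℝ) ∈ {r : ℝ | (fun _ : Fin 1 => r) ∈ K}
  · rw [if_pos (hpt.mpr h), if_pos h, hw]
  · rw [if_neg (fun h' => h (hpt.mp h')), if_neg h]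

/-- **The archimedean factor in dimension one** is the length of the part of the slice of `K`
where all forms are positive. [cite: GreenTao2010, (1.4)] -/
theorem archFactor_eq_volume_slice (Φ : Fin t → AffLinForm 1) (K : Set (Fin 1 → ℝ)) :
    archFactor Φ K = (volume ({r : ℝ | (fun _ : Fin 1 => r) ∈ K} ∩
      {r : ℝ | ∀ i, 0 < ((Φ i).coeff 0 : ℝ) * r + ((Φ i).const : ℝ)})).toReal := by
  rw [DimOne.archFactor_eq]
  have : {r : ℝ | (fun _ : Fin 1 => r) ∈ K ∧ ∀ i, 0 < (Φ i).realEval (fun _ => r)} =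
      {r : ℝ | (fun _ : Fin 1 => r) ∈ K} ∩ {r : ℝ | ∀ i, 0 < ((Φ i).coeff 0 : ℝ) * r + ((Φ i).const : ℝ)} := by
    ext r
    simp only [Set.mem_setOf_eq, Set.mem_inter_iff, DimOne.realEval_eq]
  rw [this]

/-! ### The one-signed case (all slopes positive, or all negative) -/

/-- **All slopes of one sign.** If `u = ±1` and `u aᵢ > 0` for all `i`, the ladder hypothesis gives
`BoundedDickson` for `Φ`: shift by `c = ∑ᵢ |bᵢ|` (in the direction `u`) to make the system positive,
feed the uniform `[1, M]`-estimate with `η = ε/4` into `interval_estimate` / `lattice_vs_volume`;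
all remaining quantities (`C_η`, the window sum, `|𝔖|`) are independent of `N` and `K`.
[cite: GreenTao2010, (1.2)-(1.4)] -/
theorem sameSign_case
    (H : ∀ t : ℕ, 1 ≤ t → ∀ Φ : Fin t → AffLinForm 1, IsNondegenerateSystem Φ →
      (∀ i, 0 < (Φ i).coeff 0 ∧ 0 ≤ (Φ i).const) →
        ((fun N : ℕ => ∑ n ∈ Finset.Icc 1 N, ∏ i, intVonMangoldt ((Φ i).eval ![(n : ℤ)]) -
            singularProduct Φ * N) =o[atTop] fun N : ℕ => (N : ℝ)))
    (ht : 1 ≤ t) {Φ : Fin t → AffLinForm 1} (hΦ : IsNondegenerateSystem Φ) {u : ℤ}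
    (hu : u = 1 ∨ u = -1) (hsign : ∀ i, 0 < u * (Φ i).coeff 0) {ε : ℝ} (hε : 0 < ε) :
    ∃ N₀ : ℕ, ∀ N : ℕ, N₀ ≤ N → ∀ K : Set (Fin 1 → ℝ), Convex ℝ K → K ⊆ realBox 1 N →
      |vonMangoldtSum Φ K N - archFactor Φ K * singularProduct Φ| ≤ ε * N := by
  -- the shift `c = ∑ |bᵢ|` makes `u aᵢ c + bᵢ ≥ 0`
  set c : ℤ := ∑ i, |(Φ i).const| with hc_def
  have hc0 : 0 ≤ c := Finset.sum_nonneg fun i _ => abs_nonneg _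
  have hbc : ∀ i, |(Φ i).const| ≤ c := fun i =>
    Finset.single_le_sum (f := fun i => |(Φ i).const|) (fun i _ => abs_nonneg _) (Finset.mem_univ i)
  have hpos : ∀ i, 0 < u * (Φ i).coeff 0 ∧ 0 ≤ u * (Φ i).coeff 0 * c + (Φ i).const := by
    intro i
    refine ⟨hsign i, ?_⟩
    have h1 : 1 ≤ u * (Φ i).coeff 0 := by have := hsign i; omega
    have h2 : 1 * c ≤ u * (Φ i).coeff 0 * c := mul_le_mul_of_nonneg_right h1 hc0
    linarith [hbc i, neg_abs_le ((Φ i).const)]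
  have hη : 0 < ε / 4 := by positivity
  obtain ⟨C, hC⟩ := shifted_estimate H ht hΦ hu hpos hη
  have hC0 : 0 ≤ C := by
    have := hC 0
    simp only [Nat.cast_zero, add_zero, Finset.Ioc_self, Finset.sum_empty, mul_zero, sub_zero,
      abs_zero, zero_add] at this
    exact this
  -- the fixed window `(L, c]`
  set j : Fin t := ⟨0, by omega⟩ with hj_def
  set L : ℤ := -|(Φ j).const| with hL_def
  set W : ℝ := ∑ n ∈ Finset.Ioc L c, ∏ i, intVonMangoldt ((Φ i).coeff 0 * (u * n) + (Φ i).const)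
    with hW_def
  have hW0 : 0 ≤ W := Finset.sum_nonneg fun n _ => tupleWeight_nonneg Φ _
  set 𝔖 : ℝ := singularProduct Φ with h𝔖_def
  set E₀ : ℝ := ε / 4 * (2 * |(c : ℝ)|) + 2 * C + W + |𝔖| * #(Finset.Ioc L c) with hE₀_def
  have hE₀ : 0 ≤ E₀ := by positivity
  refine ⟨⌈2 * (E₀ + |𝔖|) / ε⌉₊, fun N hN K hK hKN => ?_⟩
  have hN' : 2 * (E₀ + |𝔖|) / ε ≤ N := (Nat.le_ceil _).trans (by exact_mod_cast hN)
  rw [div_le_iff₀ hε] at hN'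
  rw [vonMangoldtSum_eq_sum_slice, archFactor_eq_volume_slice]
  have hE : 0 ≤ ε / 4 * (2 * N + 2 * |(c : ℝ)|) + 2 * C + W + |𝔖| * #(Finset.Ioc L c) := by
    positivity
  have key := lattice_vs_volume
    (F := fun n => ∏ i, intVonMangoldt ((Φ i).coeff 0 * n + (Φ i).const))
    (P := {r : ℝ | ∀ i, 0 < ((Φ i).coeff 0 : ℝ) * r + ((Φ i).const : ℝ)})
    (K' := {r : ℝ | (fun _ : Fin 1 => r) ∈ K}) (N := N) (𝔖 := 𝔖)
    (E := ε / 4 * (2 * N + 2 * |(c : ℝ)|) + 2 * C + W + |𝔖| * #(Finset.Ioc L c))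
    (fun n hn => tupleWeight_eq_zero_of_not_mem Φ hn) (ordConnected_posSet Φ)
    (ordConnected_slice hK)
    (Summit.Parity.GeneralizedHardyLittlewood.Cruxes.RelativeDimOne.TranslateAmplification.section_subset_Icc
      hKN) hE
    (fun m₁ m₂ hle h1 h2 hm₁ hm₂ => interval_estimate hu (hsign j) hη.le hC hle h1 h2 hm₁ hm₂)
  refine key.trans ?_
  rw [hE₀_def] at hN'
  nlinarith [hN', abs_nonneg (c : ℝ), abs_nonneg 𝔖]

/-! ### The mixed case -/

open Classical in
/-- **Slopes of both signs.** If `aᵢ > 0 > aⱼ`, the positivity region lies in the fixed window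
`(-|bᵢ|, |bⱼ|)`, so `0 ≤ ∑_{K ∩ ℤ} F_Φ ≤ ∑_{-|bᵢ| ≤ m ≤ |bⱼ|} F_Φ(m)` and
`0 ≤ β_∞ ≤ |bᵢ| + |bⱼ|`; the bound `ε N` holds as soon as `N ≥ (W + (|bᵢ| + |bⱼ|)|𝔖|)/ε`.
[cite: GreenTao2010, (1.2)-(1.4)] -/
theorem mixed_case {Φ : Fin t → AffLinForm 1} {i j : Fin t} (hi : 0 < (Φ i).coeff 0)
    (hj : (Φ j).coeff 0 < 0) {ε : ℝ} (hε : 0 < ε) :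
    ∃ N₀ : ℕ, ∀ N : ℕ, N₀ ≤ N → ∀ K : Set (Fin 1 → ℝ), Convex ℝ K → K ⊆ realBox 1 N →
      |vonMangoldtSum Φ K N - archFactor Φ K * singularProduct Φ| ≤ ε * N := by
  set W : ℝ := ∑ m ∈ Finset.Icc (-|(Φ i).const|) |(Φ j).const|,
    ∏ i, intVonMangoldt ((Φ i).coeff 0 * m + (Φ i).const) with hW_def
  have hW0 : 0 ≤ W := Finset.sum_nonneg fun m _ => tupleWeight_nonneg Φ m
  set 𝔖 : ℝ := singularProduct Φ with h𝔖_def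
  set B : ℝ := |((Φ i).const : ℝ)| + |((Φ j).const : ℝ)| with hB_def
  have hB0 : 0 ≤ B := by positivity
  set Q : ℝ := W + B * |𝔖| with hQ_def
  refine ⟨⌈Q / ε⌉₊, fun N hN K _ hKN => ?_⟩
  have hQN : Q / ε ≤ N := (Nat.le_ceil _).trans (by exact_mod_cast hN)
  rw [div_le_iff₀ hε] at hQN
  rw [vonMangoldtSum_eq_sum_slice, archFactor_eq_volume_slice]
  set K' : Set ℝ := {r : ℝ | (fun _ : Fin 1 => r) ∈ K} with hK'_def
  set P : Set ℝ := {r : ℝ | ∀ i, 0 < ((Φ i).coeff 0 : ℝ) * r + ((Φ i).const : ℝ)} with hP_def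
  -- the sum is carried by the window
  have hS0 : 0 ≤ ∑ m ∈ (Finset.Icc (-(N : ℤ)) N).filter (fun m : ℤ => (m : ℝ) ∈ K'),
      ∏ i, intVonMangoldt ((Φ i).coeff 0 * m + (Φ i).const) :=
    Finset.sum_nonneg fun m _ => tupleWeight_nonneg Φ m
  have hSW : ∑ m ∈ (Finset.Icc (-(N : ℤ)) N).filter (fun m : ℤ => (m : ℝ) ∈ K'),
      ∏ i, intVonMangoldt ((Φ i).coeff 0 * m + (Φ i).const) ≤ W := by
    rw [← Finset.sum_filter_ne_zero]
    refine Finset.sum_le_sum_of_subset_of_nonneg (fun m hm => ?_) (fun m _ _ => tupleWeight_nonneg Φ m)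
    rw [Finset.mem_filter] at hm
    have hP : (m : ℝ) ∈ P := by
      by_contra h
      exact hm.2 (tupleWeight_eq_zero_of_not_mem Φ h)
    have hb := mem_Ioo_of_mem_posSet Φ hi hj hP
    rw [← Int.cast_abs, ← Int.cast_abs, ← Int.cast_neg] at hb
    rw [Finset.mem_Icc]
    constructor
    · exact_mod_cast hb.1.le
    · exact_mod_cast hb.2.le
  -- the archimedean factor is at most the length of the window
  have hv0 : 0 ≤ (volume (K' ∩ P)).toReal := ENNReal.toReal_nonneg
  have hvol : (volume (K' ∩ P)).toReal ≤ B := by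
    have hsub : K' ∩ P ⊆ Set.Icc (-|((Φ i).const : ℝ)|) |((Φ j).const : ℝ)| := by
      intro r hr
      have hb := mem_Ioo_of_mem_posSet Φ hi hj hr.2
      exact ⟨hb.1.le, hb.2.le⟩
    calc (volume (K' ∩ P)).toReal
        ≤ (volume (Set.Icc (-|((Φ i).const : ℝ)|) |((Φ j).const : ℝ)|)).toReal :=
          ENNReal.toReal_mono (by rw [Real.volume_Icc]; exact ENNReal.ofReal_ne_top)
            (measure_mono hsub)
      _ = B := by
          have h0 : (0 : ℝ) ≤ |((Φ j).const : ℝ)| - -|((Φ i).const : ℝ)| := by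
            linarith [abs_nonneg ((Φ i).const : ℝ), abs_nonneg ((Φ j).const : ℝ)]
          rw [Real.volume_Icc, ENNReal.toReal_ofReal h0, hB_def]
          ring
  calc |∑ m ∈ (Finset.Icc (-(N : ℤ)) N).filter (fun m : ℤ => (m : ℝ) ∈ K'),
          ∏ i, intVonMangoldt ((Φ i).coeff 0 * m + (Φ i).const) - (volume (K' ∩ P)).toReal * 𝔖|
      ≤ |∑ m ∈ (Finset.Icc (-(N : ℤ)) N).filter (fun m : ℤ => (m : ℝ) ∈ K'),
          ∏ i, intVonMangoldt ((Φ i).coeff 0 * m + (Φ i).const)| + |(volume (K' ∩ P)).toReal * 𝔖| :=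
        abs_sub _ _
    _ = ∑ m ∈ (Finset.Icc (-(N : ℤ)) N).filter (fun m : ℤ => (m : ℝ) ∈ K'),
          ∏ i, intVonMangoldt ((Φ i).coeff 0 * m + (Φ i).const) + (volume (K' ∩ P)).toReal * |𝔖| := by
        rw [abs_of_nonneg hS0, abs_mul, abs_of_nonneg hv0]
    _ ≤ W + B * |𝔖| := add_le_add hSW (mul_le_mul_of_nonneg_right hvol (abs_nonneg _))
    _ = Q := rfl
    _ ≤ ε * N := by linarith

end

end ToBounded

/-- **stub_toBounded — Green–Tao normalisation of the ladder output.** Elementary Hardy–Littlewood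
for every positive non-degenerate fixed one-dimensional system (`∑_{n ≤ N} ∏ᵢ Λ(aᵢ n + bᵢ) =
𝔖 N + o(N)`, all `aᵢ > 0`, `bᵢ ≥ 0`) implies `BoundedDickson` verbatim: for every fixed
non-degenerate `Φ : Fin t → AffLinForm 1` (any signs), every convex `K ⊆ [-N, N]¹`,
`|∑_{K ∩ ℤ} ∏ᵢ Λ(ψᵢ(n)) − β_∞ ∏_p β_p| ≤ ε N` for `N ≥ N₀(Φ, ε)`.  Cases: all slopes positive
(translate, `ToBounded.sameSign_case` with `u = 1`), all negative (reflect, `u = -1`), mixed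
(`ToBounded.mixed_case`: everything is `O_Φ(1)`). [cite: GreenTao2010, (1.2)-(1.4)] -/
theorem stub_toBounded :
    (∀ t : ℕ, 1 ≤ t → ∀ Φ : Fin t → Literature.NumberTheory.Sieve.AffLinForm 1, Literature.NumberTheory.Sieve.IsNondegenerateSystem Φ → (∀ i, 0 < (Φ i).coeff 0 ∧ 0 ≤ (Φ i).const) → ((fun N : ℕ => ∑ n ∈ Finset.Icc 1 N, ∏ i, Literature.NumberTheory.Sieve.intVonMangoldt ((Φ i).eval ![(n : ℤ)]) - Literature.NumberTheory.Sieve.singularProduct Φ * N) =o[Filter.atTop] fun N : ℕ => (N : ℝ))) →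
      ∀ (t : ℕ) (Φ : Fin t → Literature.NumberTheory.Sieve.AffLinForm 1), 1 ≤ t → Literature.NumberTheory.Sieve.IsNondegenerateSystem Φ → ∀ ε : ℝ, 0 < ε → ∃ N₀ : ℕ, ∀ N : ℕ, N₀ ≤ N → ∀ K : Set (Fin 1 → ℝ), Convex ℝ K → K ⊆ Literature.NumberTheory.Sieve.realBox 1 N → |Literature.NumberTheory.Sieve.vonMangoldtSum Φ K N - Literature.NumberTheory.Sieve.archFactor Φ K * Literature.NumberTheory.Sieve.singularProduct Φ| ≤ ε * N := by
  intro H t Φ ht hΦ ε hε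
  have hne : ∀ i, (Φ i).coeff 0 ≠ 0 := ToBounded.coeff_zero_ne_zero hΦ
  by_cases hA : ∀ i, 0 < (Φ i).coeff 0
  · exact ToBounded.sameSign_case H ht hΦ (u := 1) (Or.inl rfl)
      (fun i => by rw [one_mul]; exact hA i) hε
  · by_cases hB : ∀ i, (Φ i).coeff 0 < 0
    · exact ToBounded.sameSign_case H ht hΦ (u := -1) (Or.inr rfl)
        (fun i => by rw [neg_one_mul, Left.neg_pos_iff]; exact hB i) hε
    · push Not at hA hB
      obtain ⟨j, hj⟩ := hA
      obtain ⟨i, hi⟩ := hB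
      exact ToBounded.mixed_case (lt_of_le_of_ne hi (hne i).symm) (lt_of_le_of_ne hj (hne j)) hε

end Summit.Parity.GeneralizedHardyLittlewood.Theorems.PairsToGHL.SlopedLadder
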